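import Summits.ValiantsHypothesis.ValiantsHypothesis.Theorems.KPlusLogSqLawTropicalShiftThreeChain
import Summits.ValiantsHypothesis.ValiantsHypothesis.Theorems.KPlusLogSqLawTropicalBPadding
import Summits.ValiantsHypothesis.ValiantsHypothesis.Theorems.LacunarySymmetroidMatrixDescartesCensusFrame

/-!
# Route «KPlusLogSqLaw», crux `Lifting` — the `K = 4` rung on the range `m ≤ 3069` (Descartes + SHIFT-THREE)

HONEST FRAMING.  Helper (partial range, no stub credit) toward the crux
`Summit.ValiantsHypothesis.ValiantsHypothesis.Theses.KPlusLogSqLaw.Lifting` (item `stmt-ValiantsHypothesis-19772`, route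
`KPlusLogSqLaw`, cell `pub-symmetroid`, seat val-sym-lift-p3, 2026-08-26): the `K = 4` analogue of the landed BC5 rung
`stub_liftRungThree`, but ONLY on the range `m + 3 ≤ 3072`:

  `lift_rung_four_of_le : m + 3 ≤ 3072 → TropRootLawAt m 4 n → RealRootLawAt m 4 (2 ^ (3 * 4) * (n + 1))`.

Why only a range, located: the real side is the Descartes ceiling `ζ(m,4) ≤ 2·C(m+3,3) − 1` (`Census.realRootLawAt_descartes`),
CUBIC in `m`; the tropical side used here is the QUADRATIC lower bound `T(m,4) ≥ T(m,3) ≥ C(m+2,2) − 2` (SHIFT-THREE,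
`choose_sub_two_le_of_tropRootLawAt_three`, padded to four classes by `tropRootLawAt_of_le_classes`), and
`3·C(m+3,3) = (m+3)·C(m+2,2)`; the factor `2^12` therefore absorbs `m + 3 ≤ 3·2^10`.  For ALL `m` at `K = 4` one needs
either a CUBIC tropical family (`Ω(m³)` distinct dominant permutations, by `card_permSteps_le` of
`…TropicalClassMonotone.lean`; the cell's belief `TropK4Law 2` says there is none) or a real bound below Descartes — the
open `K = 4` fork of `stub_liftThin` (cell file ONBOARD-val-sym.md §3.3(c)).  Nothing here asserts `Lifting`, `TropicalB`,
`KPlusLogSqLaw`, `MatrixDescartes` or anything about `VP ≠ VNP`.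
-/

set_option linter.dupNamespace false
set_option autoImplicit false

namespace Summit.ValiantsHypothesis.ValiantsHypothesis.Theorems.KPlusLogSqLaw

open Summit.ValiantsHypothesis.ValiantsHypothesis.Theorems.LacunarySymmetroidMatrixDescartes (RealRootLawAt)
open Summit.ValiantsHypothesis.ValiantsHypothesis.Theorems.LacunarySymmetroidMatrixDescartes.TropicalCensus (TropRootLawAt)

/-- `3·C(m+3,3) = (m+3)·C(m+2,2)`. [folklore] -/
theorem three_mul_choose_three (m : ℕ) : 3 * (m + 3).choose 3 = (m + 3) * (m + 2).choose 2 := by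
  have h := Nat.add_one_mul_choose_eq (m + 2) 2
  rw [show m + 2 + 1 = m + 3 from rfl, show 2 + 1 = 3 from rfl] at h
  omega

/-- the tropical row `(m, 4)` is at least the row `(m, 3)`: `C(m+2,2) − 2 ≤ n`. -/
theorem choose_sub_two_le_of_tropRootLawAt_four (m n : ℕ) (h : TropRootLawAt m 4 n) : (m + 2).choose 2 - 2 ≤ n :=
  LacunarySymmetroidMatrixDescartes.TropicalCensus.choose_sub_two_le_of_tropRootLawAt_three m n
    (tropRootLawAt_of_le_classes (by norm_num) h)

/-- **LIFT, rung `K = 4`, on the range `m + 3 ≤ 3072` (constant `2^12`):** there the quadratic tropical lower bound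
`C(m+2,2) − 2 ≤ n` and the cubic real Descartes ceiling `2·C(m+3,3) − 1` still fit under `2^12·(n+1)`. -/
theorem lift_rung_four_of_le (m n : ℕ) (hm : m + 3 ≤ 3072) (h : TropRootLawAt m 4 n) :
    RealRootLawAt m 4 (2 ^ (3 * 4) * (n + 1)) := by
  have h1 := choose_sub_two_le_of_tropRootLawAt_four m n h
  refine LacunarySymmetroidMatrixDescartes.Census.realRootLawAt_mono ?_
    (LacunarySymmetroidMatrixDescartes.Census.realRootLawAt_descartes m 4 (by norm_num))
  have h2 : Nat.choose (m + 4 - 1) m = Nat.choose (m + 3) 3 := by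
    rw [show m + 4 - 1 = m + 3 from rfl]
    exact Nat.choose_symm_add
  have h3 := three_mul_choose_three m
  have h4 : 1 ≤ (m + 2).choose 2 := Nat.choose_pos (by omega)
  rw [h2, show 2 ^ (3 * 4) = 4096 by norm_num]
  -- 6·C(m+3,3) = 2(m+3)·C(m+2,2) ≤ 6144·C(m+2,2), and C(m+2,2) ≤ n + 2
  have h5 : (m + 3) * (m + 2).choose 2 ≤ 3072 * (m + 2).choose 2 := Nat.mul_le_mul_right _ hm
  rcases Nat.eq_zero_or_pos m with hm0 | hm0
  · subst hm0
    rw [Nat.zero_add, Nat.choose_self]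
    omega
  · have h6 : 2 ≤ (m + 2).choose 2 := by
      rw [Nat.choose_two_right]
      have : 3 * 2 ≤ (m + 2) * (m + 2 - 1) := Nat.mul_le_mul (by omega) (by omega)
      omega
    omega

end Summit.ValiantsHypothesis.ValiantsHypothesis.Theorems.KPlusLogSqLaw
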